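import Mathlib
import HarnessLib
import Summits.HubbardSuperconductivity.HubbardSuperconductivity.Theorems.KLProgrammeSalmhoferCutoffSecondDerivSharp
import Summits.HubbardSuperconductivity.HubbardSuperconductivity.Theorems.KLProgrammeKLRegimeSplitConsts
import Literature.NumberTheory.Automorphic.HyperbolicDirichletForm

/-!
# Route `KLProgramme` — ENGINE (stmt-HubbardSuperconductivity-20437 `KLRegimeEngineV17F2`), located #25 «(b)-PLAIN-UV-TAIL», cure (α),
# E1 item (i): THE UV-CUT PROFILE `ĝ(ω) = σ(4/3 − 32|ω|/3)` — plateaus, `C²` size `|ψ″| ≤ 11·(32/3)²`, and the THREE-POINT (second-difference) BOUND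
# (cell gate-hubbard-kl, seat hubbard-kl-k3c2-p2 g35)

The leg weight of the cut bare vertex is `ĝ(ω) = gnScaleCutoff 4 klE0 1 |ω| = σ(4/3 − (32/3)|ω|)` (`σ = Real.smoothTransition`, `klE0 = 1/32`;
`klct_uvCutoff_eq_profile`): `≡ 1` for `|ω| ≤ 1/32`, `≡ 0` for `|ω| ≥ 1/8`.  With the tree's sharp numeral `|σ″| ≤ 11` (`klsh_abs_deriv2_smoothTransition_le`)
the one-sided profile `ψ(r) = σ(4/3 − 32r/3)` has `|ψ″| ≤ K := 11264/9` and `ψ′ = 0` off `(1/32, 1/8)` (the Literature's `deriv_smoothTransition_eq_zero`), whence by two mean-value steps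
**`klct_absProfile_secondDiff_le`**: `|ĝ(y₀+δ) − 2ĝ(y₀) + ĝ(y₀−δ)| ≤ 2Kδ²` for all `y₀` and `0 < δ ≤ 1/16` (three cases: the triple right of `−1/32`, left of `1/32`,
or straddling — there `ĝ(y₀) = 1` and each one-sided increment starts on the plateau), and it VANISHES unless `1/32 − δ < |y₀| < 1/8 + δ`
(`klct_absProfile_secondDiff_indicator`).  Consumed by `…CutCurrencyLegMass` (Σ of second differences of the Matsubara samples, spacing `δ = 2π/β`).
Elementary calculus on Mathlib's `smoothTransition`; no definition; nothing asserts any row, (b), (C), K3, U₀, the window or superconductivity.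
References: BGM 2006 §2.2 (2.9), §2.3 (2.19) [cite: BenfattoGiulianiMastropietro2006].
-/

noncomputable section

namespace Summit.HubbardSuperconductivity.HubbardSuperconductivity.Theorems.KLRegimeSplit

set_option linter.dupNamespace false -- summit = problem name (single-conjunct summit), D-0017

open Set Literature.MathematicalPhysics.QuantumLattice

/-! ## §1 `smoothTransition`: first two derivatives exist everywhere (the plateau vanishing `σ′ = 0` off `(0,1)` is the Literature's
`Literature.NumberTheory.Automorphic.deriv_smoothTransition_eq_zero`) -/

/-- `σ` and `σ′` are differentiable everywhere. -/
theorem klct_smoothTransition_differentiable :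
    Differentiable ℝ Real.smoothTransition ∧ Differentiable ℝ (deriv Real.smoothTransition) := by
  have h := contDiff_infty_iff_deriv.mp (Real.smoothTransition.contDiff (n := ⊤))
  exact ⟨h.1, (contDiff_infty_iff_deriv.mp h.2).1⟩

/-! ## §2 The one-sided profile `ψ(r) = σ(4/3 − 32r/3)` -/

/-- `ψ(r) = 1` for `r ≤ 1/32`. -/
theorem klct_profile_eq_one {r : ℝ} (hr : r ≤ 1 / 32) : Real.smoothTransition (4 / 3 - 32 / 3 * r) = 1 :=
  Real.smoothTransition.one_of_one_le (by linarith)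

/-- `ψ(r) = 0` for `1/8 ≤ r`. -/
theorem klct_profile_eq_zero {r : ℝ} (hr : 1 / 8 ≤ r) : Real.smoothTransition (4 / 3 - 32 / 3 * r) = 0 :=
  Real.smoothTransition.zero_of_nonpos (by linarith)

/-- `0 ≤ ψ ≤ 1`. -/
theorem klct_profile_mem_Icc (r : ℝ) : Real.smoothTransition (4 / 3 - 32 / 3 * r) ∈ Icc (0 : ℝ) 1 :=
  ⟨Real.smoothTransition.nonneg _, Real.smoothTransition.le_one _⟩

/-- The affine inner map. -/
theorem klct_affine_hasDerivAt (r : ℝ) : HasDerivAt (fun r : ℝ => 4 / 3 - 32 / 3 * r) (-(32 / 3)) r := by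
  simpa using ((hasDerivAt_id r).const_mul (32 / 3 : ℝ)).const_sub (4 / 3 : ℝ)

/-- `ψ′(r) = −(32/3)·σ′(4/3 − 32r/3)` (as a `HasDerivAt`). -/
theorem klct_profile_hasDerivAt (r : ℝ) :
    HasDerivAt (fun r : ℝ => Real.smoothTransition (4 / 3 - 32 / 3 * r)) (deriv Real.smoothTransition (4 / 3 - 32 / 3 * r) * (-(32 / 3))) r :=
  (klct_smoothTransition_differentiable.1 _).hasDerivAt.comp r (klct_affine_hasDerivAt r)

/-- `ψ′` in closed form. -/
theorem klct_deriv_profile (r : ℝ) :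
    deriv (fun r : ℝ => Real.smoothTransition (4 / 3 - 32 / 3 * r)) r = deriv Real.smoothTransition (4 / 3 - 32 / 3 * r) * (-(32 / 3)) :=
  (klct_profile_hasDerivAt r).deriv

/-- `ψ″(r) = (32/3)²·σ″(4/3 − 32r/3)` (as a `HasDerivAt` of `ψ′`). -/
theorem klct_deriv_profile_hasDerivAt (r : ℝ) :
    HasDerivAt (deriv (fun r : ℝ => Real.smoothTransition (4 / 3 - 32 / 3 * r)))
      (deriv (deriv Real.smoothTransition) (4 / 3 - 32 / 3 * r) * (-(32 / 3)) * (-(32 / 3))) r := by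
  have hfun : deriv (fun r : ℝ => Real.smoothTransition (4 / 3 - 32 / 3 * r)) =
      fun r => deriv Real.smoothTransition (4 / 3 - 32 / 3 * r) * (-(32 / 3)) := funext klct_deriv_profile
  rw [hfun]
  exact ((klct_smoothTransition_differentiable.2 _).hasDerivAt.comp r (klct_affine_hasDerivAt r)).mul_const _

/-- **`|ψ″| ≤ K = 11264/9`** (`= 11·(32/3)²`, from the tree's sharp `|σ″| ≤ 11`). -/
theorem klct_abs_deriv2_profile_le (r : ℝ) :
    |deriv (deriv (fun r : ℝ => Real.smoothTransition (4 / 3 - 32 / 3 * r))) r| ≤ 11264 / 9 := by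
  rw [(klct_deriv_profile_hasDerivAt r).deriv, abs_mul, abs_mul]
  have h := klsh_abs_deriv2_smoothTransition_le (4 / 3 - 32 / 3 * r)
  have h32 : |(-(32 / 3) : ℝ)| = 32 / 3 := by norm_num [abs_of_pos]
  rw [h32]
  nlinarith [abs_nonneg (deriv (deriv Real.smoothTransition) (4 / 3 - 32 / 3 * r))]

/-- **`ψ′ = 0` off the transition window**: `r ≤ 1/32` or `1/8 ≤ r`. -/
theorem klct_deriv_profile_eq_zero {r : ℝ} (hr : r ≤ 1 / 32 ∨ 1 / 8 ≤ r) :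
    deriv (fun r : ℝ => Real.smoothTransition (4 / 3 - 32 / 3 * r)) r = 0 := by
  rw [klct_deriv_profile, Literature.NumberTheory.Automorphic.deriv_smoothTransition_eq_zero, zero_mul]
  rcases hr with hr | hr
  · right; linarith
  · left; linarith

/-- **`ψ′` is `K`-Lipschitz.** -/
theorem klct_deriv_profile_lipschitz (r₁ r₂ : ℝ) :
    |deriv (fun r : ℝ => Real.smoothTransition (4 / 3 - 32 / 3 * r)) r₁ - deriv (fun r : ℝ => Real.smoothTransition (4 / 3 - 32 / 3 * r)) r₂| ≤
      11264 / 9 * |r₁ - r₂| := by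
  have h := Convex.norm_image_sub_le_of_norm_deriv_le (f := deriv (fun r : ℝ => Real.smoothTransition (4 / 3 - 32 / 3 * r))) (s := univ)
    (fun x _ => (klct_deriv_profile_hasDerivAt x).differentiableAt)
    (fun x _ => by rw [Real.norm_eq_abs]; exact klct_abs_deriv2_profile_le x) convex_univ (mem_univ r₂) (mem_univ r₁)
  simpa only [Real.norm_eq_abs] using h

/-- The profile is differentiable, hence continuous. -/
theorem klct_profile_differentiable : Differentiable ℝ (fun r : ℝ => Real.smoothTransition (4 / 3 - 32 / 3 * r)) :=
  fun r => (klct_profile_hasDerivAt r).differentiableAt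

/-- **Second-difference bound for `ψ`** (two mean-value steps): `|ψ(x+δ) − 2ψ(x) + ψ(x−δ)| ≤ 2Kδ²` for `0 < δ`. -/
theorem klct_profile_secondDiff_le (x : ℝ) {δ : ℝ} (hδ : 0 < δ) :
    |Real.smoothTransition (4 / 3 - 32 / 3 * (x + δ)) - 2 * Real.smoothTransition (4 / 3 - 32 / 3 * x) + Real.smoothTransition (4 / 3 - 32 / 3 * (x - δ))| ≤
      2 * (11264 / 9) * δ ^ 2 := by
  set P : ℝ → ℝ := fun r => Real.smoothTransition (4 / 3 - 32 / 3 * r) with hP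
  have hPd := klct_profile_differentiable
  obtain ⟨ξ₁, hξ₁, h₁⟩ := exists_deriv_eq_slope P (by linarith : x < x + δ) hPd.continuous.continuousOn (hPd.differentiableOn)
  obtain ⟨ξ₂, hξ₂, h₂⟩ := exists_deriv_eq_slope P (by linarith : x - δ < x) hPd.continuous.continuousOn (hPd.differentiableOn)
  have e₁ : P (x + δ) - P x = δ * deriv P ξ₁ := by rw [h₁, add_sub_cancel_left, mul_div_cancel₀ _ hδ.ne']
  have e₂ : P x - P (x - δ) = δ * deriv P ξ₂ := by rw [h₂, sub_sub_cancel, mul_div_cancel₀ _ hδ.ne']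
  have hkey : P (x + δ) - 2 * P x + P (x - δ) = δ * (deriv P ξ₁ - deriv P ξ₂) := by linear_combination e₁ - e₂
  show |P (x + δ) - 2 * P x + P (x - δ)| ≤ 2 * (11264 / 9) * δ ^ 2
  rw [hkey, abs_mul, abs_of_pos hδ]
  have hL := klct_deriv_profile_lipschitz ξ₁ ξ₂
  have hdist : |ξ₁ - ξ₂| ≤ 2 * δ := by
    rw [abs_le]; constructor <;> linarith [hξ₁.1, hξ₁.2, hξ₂.1, hξ₂.2]
  calc δ * |deriv P ξ₁ - deriv P ξ₂| ≤ δ * (11264 / 9 * (2 * δ)) := by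
        apply mul_le_mul_of_nonneg_left _ hδ.le
        exact hL.trans (by gcongr)
    _ = 2 * (11264 / 9) * δ ^ 2 := by ring

/-- **One-sided increment from the upper plateau**: `|ψ(x+δ) − ψ(x)| ≤ Kδ²` for `x ≤ 1/32`, `0 < δ` (there `ψ′(x) = 0`). -/
theorem klct_profile_oneDiff_le {x δ : ℝ} (hδ : 0 < δ) (hx : x ≤ 1 / 32) :
    |Real.smoothTransition (4 / 3 - 32 / 3 * (x + δ)) - Real.smoothTransition (4 / 3 - 32 / 3 * x)| ≤ 11264 / 9 * δ ^ 2 := by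
  set P : ℝ → ℝ := fun r => Real.smoothTransition (4 / 3 - 32 / 3 * r) with hP
  have hPd := klct_profile_differentiable
  obtain ⟨ξ, hξ, h⟩ := exists_deriv_eq_slope P (by linarith : x < x + δ) hPd.continuous.continuousOn (hPd.differentiableOn)
  have e : P (x + δ) - P x = δ * (deriv P ξ - deriv P x) := by
    rw [show deriv P x = 0 from klct_deriv_profile_eq_zero (Or.inl hx), sub_zero, h, add_sub_cancel_left, mul_div_cancel₀ _ hδ.ne']
  show |P (x + δ) - P x| ≤ 11264 / 9 * δ ^ 2
  rw [e, abs_mul, abs_of_pos hδ]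
  have hL := klct_deriv_profile_lipschitz ξ x
  have hdist : |ξ - x| ≤ δ := by rw [abs_le]; constructor <;> linarith [hξ.1, hξ.2]
  calc δ * |deriv P ξ - deriv P x| ≤ δ * (11264 / 9 * δ) := by
        apply mul_le_mul_of_nonneg_left _ hδ.le
        exact hL.trans (by gcongr)
    _ = 11264 / 9 * δ ^ 2 := by ring

/-! ## §3 The symmetric profile `ĝ(y) = ψ(|y|)` and its three-point bound -/

/-- **The cut is the profile**: `gnScaleCutoff 4 klE0 1 |y| = σ(4/3 − (32/3)|y|)`. -/
theorem klct_uvCutoff_eq_profile (y : ℝ) : gnScaleCutoff 4 klE0 1 |y| = Real.smoothTransition (4 / 3 - 32 / 3 * |y|) := by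
  rw [gnScaleCutoff, gnCutoff, klE0]
  congr 1
  rw [zpow_neg, zpow_one]
  field_simp
  ring

/-- Right of `−1/32` the symmetric profile is the one-sided one: `ψ(|p|) = ψ(p)` for `−1/32 ≤ p`. -/
theorem klct_absProfile_eq_of_ge {p : ℝ} (hp : -(1 / 32) ≤ p) :
    Real.smoothTransition (4 / 3 - 32 / 3 * |p|) = Real.smoothTransition (4 / 3 - 32 / 3 * p) := by
  rcases le_or_gt 0 p with h | h
  · rw [abs_of_nonneg h]
  · rw [abs_of_neg h, klct_profile_eq_one (by linarith), klct_profile_eq_one (by linarith)]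

/-- Left of `1/32`: `ψ(|p|) = ψ(−p)` for `p ≤ 1/32`. -/
theorem klct_absProfile_eq_of_le {p : ℝ} (hp : p ≤ 1 / 32) :
    Real.smoothTransition (4 / 3 - 32 / 3 * |p|) = Real.smoothTransition (4 / 3 - 32 / 3 * (-p)) := by
  rcases le_or_gt 0 p with h | h
  · rw [abs_of_nonneg h, klct_profile_eq_one hp, klct_profile_eq_one (by linarith)]
  · rw [abs_of_neg h]

/-- **THREE-POINT BOUND FOR THE CUT PROFILE**: `|ĝ(y₀+δ) − 2ĝ(y₀) + ĝ(y₀−δ)| ≤ 2Kδ²` for every centre `y₀` and `0 < δ ≤ 1/16` (`K = 11264/9`). -/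
theorem klct_absProfile_secondDiff_le (y₀ : ℝ) {δ : ℝ} (hδ : 0 < δ) (hδ' : δ ≤ 1 / 16) :
    |Real.smoothTransition (4 / 3 - 32 / 3 * |y₀ + δ|) - 2 * Real.smoothTransition (4 / 3 - 32 / 3 * |y₀|) +
        Real.smoothTransition (4 / 3 - 32 / 3 * |y₀ - δ|)| ≤ 2 * (11264 / 9) * δ ^ 2 := by
  by_cases hA : -(1 / 32) ≤ y₀ - δ
  · -- the whole triple is right of `−1/32`
    rw [klct_absProfile_eq_of_ge (by linarith : -(1 / 32) ≤ y₀ + δ), klct_absProfile_eq_of_ge (by linarith : -(1 / 32) ≤ y₀), klct_absProfile_eq_of_ge hA]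
    exact klct_profile_secondDiff_le y₀ hδ
  by_cases hB : y₀ + δ ≤ 1 / 32
  · -- the whole triple is left of `1/32`: reflect
    rw [klct_absProfile_eq_of_le hB, klct_absProfile_eq_of_le (by linarith : y₀ ≤ 1 / 32), klct_absProfile_eq_of_le (by linarith : y₀ - δ ≤ 1 / 32),
      show -(y₀ + δ) = -y₀ - δ by ring, show -(y₀ - δ) = -y₀ + δ by ring]
    have h := klct_profile_secondDiff_le (-y₀) hδ
    rwa [show Real.smoothTransition (4 / 3 - 32 / 3 * (-y₀ + δ)) - 2 * Real.smoothTransition (4 / 3 - 32 / 3 * -y₀) +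
        Real.smoothTransition (4 / 3 - 32 / 3 * (-y₀ - δ)) = Real.smoothTransition (4 / 3 - 32 / 3 * (-y₀ - δ)) -
        2 * Real.smoothTransition (4 / 3 - 32 / 3 * -y₀) + Real.smoothTransition (4 / 3 - 32 / 3 * (-y₀ + δ)) by ring] at h
  -- straddling: `|y₀| < δ − 1/32 ≤ 1/32`, centre on the plateau
  push Not at hA hB
  have hy0 : |y₀| ≤ 1 / 32 := by rw [abs_le]; constructor <;> linarith
  have hc : Real.smoothTransition (4 / 3 - 32 / 3 * |y₀|) = 1 := klct_profile_eq_one hy0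
  have hp : Real.smoothTransition (4 / 3 - 32 / 3 * |y₀ + δ|) = Real.smoothTransition (4 / 3 - 32 / 3 * (y₀ + δ)) := by
    rw [abs_of_pos (by linarith)]
  have hm : Real.smoothTransition (4 / 3 - 32 / 3 * |y₀ - δ|) = Real.smoothTransition (4 / 3 - 32 / 3 * (-y₀ + δ)) := by
    rw [abs_of_neg (by linarith)]; ring_nf
  have h1 := klct_profile_oneDiff_le hδ (show y₀ ≤ 1 / 32 by linarith [le_abs_self y₀])
  have h2 := klct_profile_oneDiff_le hδ (show -y₀ ≤ 1 / 32 by linarith [neg_abs_le y₀])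
  rw [klct_profile_eq_one (show y₀ ≤ 1 / 32 by linarith [le_abs_self y₀])] at h1
  rw [klct_profile_eq_one (show -y₀ ≤ 1 / 32 by linarith [neg_abs_le y₀])] at h2
  rw [hp, hc, hm]
  have hsplit : Real.smoothTransition (4 / 3 - 32 / 3 * (y₀ + δ)) - 2 * 1 + Real.smoothTransition (4 / 3 - 32 / 3 * (-y₀ + δ)) =
      (Real.smoothTransition (4 / 3 - 32 / 3 * (y₀ + δ)) - 1) + (Real.smoothTransition (4 / 3 - 32 / 3 * (-y₀ + δ)) - 1) := by ring
  rw [hsplit]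
  refine (abs_add_le _ _).trans ?_
  linarith

/-- **…and it vanishes off the window `1/32 − δ < |y₀| < 1/8 + δ`** (inner plateau: all three values `1`; outer: all `0`):
`|ĝ(y₀+δ) − 2ĝ(y₀) + ĝ(y₀−δ)| ≤ 2Kδ²·𝟙[1/32 < |y₀| + δ ∧ |y₀| < 1/8 + δ]` (`0 < δ ≤ 1/16`). -/
theorem klct_absProfile_secondDiff_indicator (y₀ : ℝ) {δ : ℝ} (hδ : 0 < δ) (hδ' : δ ≤ 1 / 16) :
    |Real.smoothTransition (4 / 3 - 32 / 3 * |y₀ + δ|) - 2 * Real.smoothTransition (4 / 3 - 32 / 3 * |y₀|) +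
        Real.smoothTransition (4 / 3 - 32 / 3 * |y₀ - δ|)| ≤
      2 * (11264 / 9) * δ ^ 2 * (if 1 / 32 < |y₀| + δ ∧ |y₀| < 1 / 8 + δ then 1 else 0) := by
  split_ifs with hw
  · rw [mul_one]; exact klct_absProfile_secondDiff_le y₀ hδ hδ'
  rw [mul_zero]
  refine le_of_eq (abs_eq_zero.mpr ?_)
  rw [not_and_or, not_lt, not_lt] at hw
  rcases hw with hin | hout
  · -- inner plateau: `|y₀ ± δ| ≤ |y₀| + δ ≤ 1/32`
    have h1 : |y₀ + δ| ≤ 1 / 32 := (abs_add_le _ _).trans (by rw [abs_of_pos hδ]; exact hin)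
    have h2 : |y₀| ≤ 1 / 32 := by linarith [abs_nonneg y₀]
    have h3 : |y₀ - δ| ≤ 1 / 32 := (abs_sub _ _).trans (by rw [abs_of_pos hδ]; exact hin)
    rw [klct_profile_eq_one h1, klct_profile_eq_one h2, klct_profile_eq_one h3]; ring
  · -- outer plateau: `|y₀ ± δ| ≥ |y₀| − δ ≥ 1/8`
    have h1 : 1 / 8 ≤ |y₀ + δ| := by
      have := abs_sub_abs_le_abs_sub y₀ (-δ); rw [sub_neg_eq_add, abs_neg, abs_of_pos hδ] at this; linarith
    have h2 : 1 / 8 ≤ |y₀| := by linarith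
    have h3 : 1 / 8 ≤ |y₀ - δ| := by
      have := abs_sub_abs_le_abs_sub y₀ δ; rw [abs_of_pos hδ] at this; linarith
    rw [klct_profile_eq_zero h1, klct_profile_eq_zero h2, klct_profile_eq_zero h3]; ring

end Summit.HubbardSuperconductivity.HubbardSuperconductivity.Theorems.KLRegimeSplit

end
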